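import Mathlib
import HarnessLib
import Summits.Ventures.LatticeQCDFlow.Exactness.IMHDelayedRejectionRate
import Summits.Ventures.LatticeQCDFlow.Scaling.AutoregressiveGaugeHeatBathColdExact

/-!
# LatticeQCDFlow / Scaling — the DELAYED-REJECTION version of the exact one-plaquette heat-bath gauge sampler (`A = Z/(c^{#B}M^k)`): after a rejected
# heat-bath proposal a SECOND one is drawn and accepted with the Tierney–Mira ratio — EXACT for the Wilson-type law, convergent from every start
# at rate at least `A` per update

HONEST FRAMING: exact (Metropolis-corrected) sampling algorithms for lattice gauge theory;
figures of merit are autocorrelation/cost numbers at stated couplings and volumes; no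
continuum-physics claim.

Venture `LatticeQCDFlow` (cell pub-lqcd), topic `Scaling`, FANOUT row 30 (lean-1, GEN-43) — OUR WORK, the gauge instance of this generation's
abstract `Exactness/IMHDelayedRejectionExact` and `Exactness/IMHDelayedRejectionRate` for the exact one-plaquette heat-bath sampler of
`Scaling/AutoregressiveGaugeHeatBathColdExact` (plaquette weight `w` continuous, pinched `0 < m₀ ≤ w ≤ M₀` with `w(1) = M₀`; heat-bath plaquettes `B`
redrawn along admissible links `t` in an acyclic order `rank`; target `π` = the Wilson-type law `∏_p w(U_p)·Haar^{⊗E}/Z`; proposal `q` = the heat-bath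
law; importance weight `dπ/dq`, maximal at the cold configuration where it equals `1/A`, `A = Z/(c^{#B} M₀^{#Bᶜ})`, `c = ∫ w dHaar`).  DEF-FREE: the
delayed-rejection kernel is any kernel `K` satisfying the two-stage equation of `IMHDelayedRejectionExact` for `q` and this weight (first proposal
accepted with the Metropolis ratio; upon rejection a second, independent heat-bath proposal accepted with the Tierney–Mira ratio; else stay).
Compare GEN-42's `Scaling/AutoregressiveGaugeHeatBathMultipleTry` (multiple try) and GEN-41's `…MultiProposal` (pool selection).

* **`heatBath_delayedRejection_invariant`** — `∫ K(U, S) π(dU) = π(S)`: THE DELAYED-REJECTION HEAT-BATH SAMPLER IS EXACT FOR THE WILSON-TYPE LAW.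
* **`heatBath_delayedRejection_uniformlyErgodic`** — `|μ₀Kᵗ(S) − π(S)| ≤ (1 − A)ᵗ` for every initial law, every `t`, every set `S`, with
  `A = Z/(c^{#B} M₀^{#Bᶜ})`: the second chance keeps the plain sampler's guaranteed rate (it cannot lose it, and by
  `Exactness/IMHDelayedRejectionStickingFloor` it cannot beat the sticking bill either).
NOT CLAIMED: that the second proposal pays for its cost; any value of `A`.  No `def`, no `sorry`, nothing cited as a fact.
-/

noncomputable section

namespace Summit.Ventures.LatticeQCDFlow.Theory2.Autoregressive

open MeasureTheory ProbabilityTheory Function Finset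
open scoped ENNReal
open Literature.MathematicalPhysics.QuantumFieldTheory Literature.MathematicalPhysics.QuantumLattice
open Summit.Ventures.LatticeQCDFlow.Exactness Summit.Ventures.LatticeQCDFlow.Scoring

variable {d L : ℕ} [NeZero L] {G : Type*} [Group G] [TopologicalSpace G] [IsTopologicalGroup G]
  [CompactSpace G] [SecondCountableTopology G] [MeasurableSpace G] [BorelSpace G]

/-- **THE DELAYED-REJECTION HEAT-BATH SAMPLER IS EXACT**: `∫ K(U, S) π(dU) = π(S)` for every measurable `S`. [ours] -/
theorem heatBath_delayedRejection_invariant (hL : 2 ≤ L) {w : G → ℝ} (hw : Continuous w) {m₀ M₀ : ℝ} (hm0 : 0 < m₀)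
    (hm : ∀ g, m₀ ≤ w g) (hM : ∀ g, w g ≤ M₀) (hw1 : w 1 = M₀)
    (B : Finset (Plaquette d L)) (t : Plaquette d L → Edge d L)
    (ht : ∀ p ∈ B, t p ∈ ({(p.1, p.2.1.1), (p.1.shift p.2.1.1, p.2.1.2),
        (p.1.shift p.2.1.2, p.2.1.1), (p.1, p.2.1.2)} : Finset (Edge d L)))
    (rank : Plaquette d L → ℕ)
    (hrank : ∀ p ∈ B, ∀ p' ∈ B, p ≠ p' → t p ∈ ({(p'.1, p'.2.1.1), (p'.1.shift p'.2.1.1, p'.2.1.2),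
        (p'.1.shift p'.2.1.2, p'.2.1.1), (p'.1, p'.2.1.2)} : Finset (Edge d L)) → rank p < rank p')
    (π q : Measure (GaugeConfig d L G)) [IsProbabilityMeasure π] [IsProbabilityMeasure q]
    (hπ : π = (Measure.pi fun _ : Edge d L => haarProbability G).withDensity fun U =>
      ENNReal.ofReal ((∏ p : Plaquette d L, w (plaquetteHolonomy U p.1 p.2.1.1 p.2.1.2)) /
        ∫ V, ∏ p : Plaquette d L, w (plaquetteHolonomy V p.1 p.2.1.1 p.2.1.2)
          ∂(Measure.pi fun _ : Edge d L => haarProbability G)))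
    (hq : q = (Measure.pi fun _ : Edge d L => haarProbability G).withDensity fun U =>
      ENNReal.ofReal ((∏ p ∈ B, w (plaquetteHolonomy U p.1 p.2.1.1 p.2.1.2)) /
        ∫ V, ∏ p ∈ B, w (plaquetteHolonomy V p.1 p.2.1.1 p.2.1.2)
          ∂(Measure.pi fun _ : Edge d L => haarProbability G)))
    (K : Kernel (GaugeConfig d L G) (GaugeConfig d L G))
    (hK : ∀ (U : GaugeConfig d L G) {S : Set (GaugeConfig d L G)}, MeasurableSet S → K U S =
      ∫⁻ V in S, imhAcceptE (fun U : GaugeConfig d L G => (((∫ V, ∏ p : Plaquette d L, w (plaquetteHolonomy V p.1 p.2.1.1 p.2.1.2) ∂(Measure.pi fun _ : Edge d L => haarProbability G)) /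
          ((∫ V, ∏ p ∈ B, w (plaquetteHolonomy V p.1 p.2.1.1 p.2.1.2)
            ∂(Measure.pi fun _ : Edge d L => haarProbability G)) *
            ∏ p ∈ Finset.univ \ B, w (plaquetteHolonomy U p.1 p.2.1.1 p.2.1.2))))⁻¹) U V ∂q +
        ∫⁻ V₁, ∫⁻ V₂ in S, ENNReal.ofReal (min (1 - imhAccept (fun U : GaugeConfig d L G => (((∫ V, ∏ p : Plaquette d L, w (plaquetteHolonomy V p.1 p.2.1.1 p.2.1.2) ∂(Measure.pi fun _ : Edge d L => haarProbability G)) /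
          ((∫ V, ∏ p ∈ B, w (plaquetteHolonomy V p.1 p.2.1.1 p.2.1.2)
            ∂(Measure.pi fun _ : Edge d L => haarProbability G)) *
            ∏ p ∈ Finset.univ \ B, w (plaquetteHolonomy U p.1 p.2.1.1 p.2.1.2))))⁻¹) U V₁) ((fun U : GaugeConfig d L G => (((∫ V, ∏ p : Plaquette d L, w (plaquetteHolonomy V p.1 p.2.1.1 p.2.1.2) ∂(Measure.pi fun _ : Edge d L => haarProbability G)) /
          ((∫ V, ∏ p ∈ B, w (plaquetteHolonomy V p.1 p.2.1.1 p.2.1.2)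
            ∂(Measure.pi fun _ : Edge d L => haarProbability G)) *
            ∏ p ∈ Finset.univ \ B, w (plaquetteHolonomy U p.1 p.2.1.1 p.2.1.2))))⁻¹) V₂ * (1 - imhAccept (fun U : GaugeConfig d L G => (((∫ V, ∏ p : Plaquette d L, w (plaquetteHolonomy V p.1 p.2.1.1 p.2.1.2) ∂(Measure.pi fun _ : Edge d L => haarProbability G)) /
          ((∫ V, ∏ p ∈ B, w (plaquetteHolonomy V p.1 p.2.1.1 p.2.1.2)
            ∂(Measure.pi fun _ : Edge d L => haarProbability G)) *
            ∏ p ∈ Finset.univ \ B, w (plaquetteHolonomy U p.1 p.2.1.1 p.2.1.2))))⁻¹) V₂ V₁) / (fun U : GaugeConfig d L G => (((∫ V, ∏ p : Plaquette d L, w (plaquetteHolonomy V p.1 p.2.1.1 p.2.1.2) ∂(Measure.pi fun _ : Edge d L => haarProbability G)) /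
          ((∫ V, ∏ p ∈ B, w (plaquetteHolonomy V p.1 p.2.1.1 p.2.1.2)
            ∂(Measure.pi fun _ : Edge d L => haarProbability G)) *
            ∏ p ∈ Finset.univ \ B, w (plaquetteHolonomy U p.1 p.2.1.1 p.2.1.2))))⁻¹) U)) ∂q ∂q +
        (1 - (imhAcceptMass q (fun U : GaugeConfig d L G => (((∫ V, ∏ p : Plaquette d L, w (plaquetteHolonomy V p.1 p.2.1.1 p.2.1.2) ∂(Measure.pi fun _ : Edge d L => haarProbability G)) /
          ((∫ V, ∏ p ∈ B, w (plaquetteHolonomy V p.1 p.2.1.1 p.2.1.2)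
            ∂(Measure.pi fun _ : Edge d L => haarProbability G)) *
            ∏ p ∈ Finset.univ \ B, w (plaquetteHolonomy U p.1 p.2.1.1 p.2.1.2))))⁻¹) U +
          ∫⁻ V₁, ∫⁻ V₂, ENNReal.ofReal (min (1 - imhAccept (fun U : GaugeConfig d L G => (((∫ V, ∏ p : Plaquette d L, w (plaquetteHolonomy V p.1 p.2.1.1 p.2.1.2) ∂(Measure.pi fun _ : Edge d L => haarProbability G)) /
          ((∫ V, ∏ p ∈ B, w (plaquetteHolonomy V p.1 p.2.1.1 p.2.1.2)
            ∂(Measure.pi fun _ : Edge d L => haarProbability G)) *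
            ∏ p ∈ Finset.univ \ B, w (plaquetteHolonomy U p.1 p.2.1.1 p.2.1.2))))⁻¹) U V₁) ((fun U : GaugeConfig d L G => (((∫ V, ∏ p : Plaquette d L, w (plaquetteHolonomy V p.1 p.2.1.1 p.2.1.2) ∂(Measure.pi fun _ : Edge d L => haarProbability G)) /
          ((∫ V, ∏ p ∈ B, w (plaquetteHolonomy V p.1 p.2.1.1 p.2.1.2)
            ∂(Measure.pi fun _ : Edge d L => haarProbability G)) *
            ∏ p ∈ Finset.univ \ B, w (plaquetteHolonomy U p.1 p.2.1.1 p.2.1.2))))⁻¹) V₂ * (1 - imhAccept (fun U : GaugeConfig d L G => (((∫ V, ∏ p : Plaquette d L, w (plaquetteHolonomy V p.1 p.2.1.1 p.2.1.2) ∂(Measure.pi fun _ : Edge d L => haarProbability G)) /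
          ((∫ V, ∏ p ∈ B, w (plaquetteHolonomy V p.1 p.2.1.1 p.2.1.2)
            ∂(Measure.pi fun _ : Edge d L => haarProbability G)) *
            ∏ p ∈ Finset.univ \ B, w (plaquetteHolonomy U p.1 p.2.1.1 p.2.1.2))))⁻¹) V₂ V₁) / (fun U : GaugeConfig d L G => (((∫ V, ∏ p : Plaquette d L, w (plaquetteHolonomy V p.1 p.2.1.1 p.2.1.2) ∂(Measure.pi fun _ : Edge d L => haarProbability G)) /
          ((∫ V, ∏ p ∈ B, w (plaquetteHolonomy V p.1 p.2.1.1 p.2.1.2)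
            ∂(Measure.pi fun _ : Edge d L => haarProbability G)) *
            ∏ p ∈ Finset.univ \ B, w (plaquetteHolonomy U p.1 p.2.1.1 p.2.1.2))))⁻¹) U)) ∂q ∂q)) * S.indicator 1 U)
    {S : Set (GaugeConfig d L G)} (hS : MeasurableSet S) :
    ∫⁻ U, K U S ∂π = π S := by
  obtain ⟨_, hρq, _, hρm, hρpos⟩ := heatBath_cold_acceptMass_eq hL hw hm0 hm hM hw1 B t ht rank hrank π q hπ hq
  set ρ : GaugeConfig d L G → ℝ := fun U => ((∫ V, ∏ p : Plaquette d L, w (plaquetteHolonomy V p.1 p.2.1.1 p.2.1.2) ∂(Measure.pi fun _ : Edge d L => haarProbability G)) /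
          ((∫ V, ∏ p ∈ B, w (plaquetteHolonomy V p.1 p.2.1.1 p.2.1.2)
            ∂(Measure.pi fun _ : Edge d L => haarProbability G)) *
            ∏ p ∈ Finset.univ \ B, w (plaquetteHolonomy U p.1 p.2.1.1 p.2.1.2))) with hρ
  have hw0' : ∀ U, 0 < (ρ U)⁻¹ := fun U => inv_pos.2 (hρpos U)
  have hwm' : Measurable fun U => (ρ U)⁻¹ := hρm.inv
  have hπ' : (q.withDensity fun U => ENNReal.ofReal (ρ U)⁻¹) = π := withDensity_inv_density hρm hρpos hρq
  haveI : IsMarkovKernel K := dr_isMarkovKernel (q := q) (w := fun U => (ρ U)⁻¹) hwm' hw0' K hK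
  have h := (delayedRejection_invariant (q := q) (w := fun U => (ρ U)⁻¹) hwm' hw0' K hK).def
  rw [hπ'] at h
  have h2 := congrArg (fun μ : Measure (GaugeConfig d L G) => μ S) h
  rwa [Measure.bind_apply hS (Kernel.aemeasurable _)] at h2

/-- **THE SECOND CHANCE KEEPS THE RATE**: for every initial law `μ₀`, every `t` and every set `S`,
`|μ₀Kᵗ(S) − π(S)| ≤ (1 − A)ᵗ` with `A = Z/(c^{#B} M₀^{#Bᶜ})` the displayed cold acceptance. [ours] -/
theorem heatBath_delayedRejection_uniformlyErgodic (hL : 2 ≤ L) {w : G → ℝ} (hw : Continuous w) {m₀ M₀ : ℝ} (hm0 : 0 < m₀)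
    (hm : ∀ g, m₀ ≤ w g) (hM : ∀ g, w g ≤ M₀) (hw1 : w 1 = M₀)
    (B : Finset (Plaquette d L)) (t : Plaquette d L → Edge d L)
    (ht : ∀ p ∈ B, t p ∈ ({(p.1, p.2.1.1), (p.1.shift p.2.1.1, p.2.1.2),
        (p.1.shift p.2.1.2, p.2.1.1), (p.1, p.2.1.2)} : Finset (Edge d L)))
    (rank : Plaquette d L → ℕ)
    (hrank : ∀ p ∈ B, ∀ p' ∈ B, p ≠ p' → t p ∈ ({(p'.1, p'.2.1.1), (p'.1.shift p'.2.1.1, p'.2.1.2),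
        (p'.1.shift p'.2.1.2, p'.2.1.1), (p'.1, p'.2.1.2)} : Finset (Edge d L)) → rank p < rank p')
    (π q : Measure (GaugeConfig d L G)) [IsProbabilityMeasure π] [IsProbabilityMeasure q]
    (hπ : π = (Measure.pi fun _ : Edge d L => haarProbability G).withDensity fun U =>
      ENNReal.ofReal ((∏ p : Plaquette d L, w (plaquetteHolonomy U p.1 p.2.1.1 p.2.1.2)) /
        ∫ V, ∏ p : Plaquette d L, w (plaquetteHolonomy V p.1 p.2.1.1 p.2.1.2)
          ∂(Measure.pi fun _ : Edge d L => haarProbability G)))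
    (hq : q = (Measure.pi fun _ : Edge d L => haarProbability G).withDensity fun U =>
      ENNReal.ofReal ((∏ p ∈ B, w (plaquetteHolonomy U p.1 p.2.1.1 p.2.1.2)) /
        ∫ V, ∏ p ∈ B, w (plaquetteHolonomy V p.1 p.2.1.1 p.2.1.2)
          ∂(Measure.pi fun _ : Edge d L => haarProbability G)))
    (K : Kernel (GaugeConfig d L G) (GaugeConfig d L G))
    (hK : ∀ (U : GaugeConfig d L G) {S : Set (GaugeConfig d L G)}, MeasurableSet S → K U S =
      ∫⁻ V in S, imhAcceptE (fun U : GaugeConfig d L G => (((∫ V, ∏ p : Plaquette d L, w (plaquetteHolonomy V p.1 p.2.1.1 p.2.1.2) ∂(Measure.pi fun _ : Edge d L => haarProbability G)) /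
          ((∫ V, ∏ p ∈ B, w (plaquetteHolonomy V p.1 p.2.1.1 p.2.1.2)
            ∂(Measure.pi fun _ : Edge d L => haarProbability G)) *
            ∏ p ∈ Finset.univ \ B, w (plaquetteHolonomy U p.1 p.2.1.1 p.2.1.2))))⁻¹) U V ∂q +
        ∫⁻ V₁, ∫⁻ V₂ in S, ENNReal.ofReal (min (1 - imhAccept (fun U : GaugeConfig d L G => (((∫ V, ∏ p : Plaquette d L, w (plaquetteHolonomy V p.1 p.2.1.1 p.2.1.2) ∂(Measure.pi fun _ : Edge d L => haarProbability G)) /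
          ((∫ V, ∏ p ∈ B, w (plaquetteHolonomy V p.1 p.2.1.1 p.2.1.2)
            ∂(Measure.pi fun _ : Edge d L => haarProbability G)) *
            ∏ p ∈ Finset.univ \ B, w (plaquetteHolonomy U p.1 p.2.1.1 p.2.1.2))))⁻¹) U V₁) ((fun U : GaugeConfig d L G => (((∫ V, ∏ p : Plaquette d L, w (plaquetteHolonomy V p.1 p.2.1.1 p.2.1.2) ∂(Measure.pi fun _ : Edge d L => haarProbability G)) /
          ((∫ V, ∏ p ∈ B, w (plaquetteHolonomy V p.1 p.2.1.1 p.2.1.2)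
            ∂(Measure.pi fun _ : Edge d L => haarProbability G)) *
            ∏ p ∈ Finset.univ \ B, w (plaquetteHolonomy U p.1 p.2.1.1 p.2.1.2))))⁻¹) V₂ * (1 - imhAccept (fun U : GaugeConfig d L G => (((∫ V, ∏ p : Plaquette d L, w (plaquetteHolonomy V p.1 p.2.1.1 p.2.1.2) ∂(Measure.pi fun _ : Edge d L => haarProbability G)) /
          ((∫ V, ∏ p ∈ B, w (plaquetteHolonomy V p.1 p.2.1.1 p.2.1.2)
            ∂(Measure.pi fun _ : Edge d L => haarProbability G)) *
            ∏ p ∈ Finset.univ \ B, w (plaquetteHolonomy U p.1 p.2.1.1 p.2.1.2))))⁻¹) V₂ V₁) / (fun U : GaugeConfig d L G => (((∫ V, ∏ p : Plaquette d L, w (plaquetteHolonomy V p.1 p.2.1.1 p.2.1.2) ∂(Measure.pi fun _ : Edge d L => haarProbability G)) /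
          ((∫ V, ∏ p ∈ B, w (plaquetteHolonomy V p.1 p.2.1.1 p.2.1.2)
            ∂(Measure.pi fun _ : Edge d L => haarProbability G)) *
            ∏ p ∈ Finset.univ \ B, w (plaquetteHolonomy U p.1 p.2.1.1 p.2.1.2))))⁻¹) U)) ∂q ∂q +
        (1 - (imhAcceptMass q (fun U : GaugeConfig d L G => (((∫ V, ∏ p : Plaquette d L, w (plaquetteHolonomy V p.1 p.2.1.1 p.2.1.2) ∂(Measure.pi fun _ : Edge d L => haarProbability G)) /
          ((∫ V, ∏ p ∈ B, w (plaquetteHolonomy V p.1 p.2.1.1 p.2.1.2)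
            ∂(Measure.pi fun _ : Edge d L => haarProbability G)) *
            ∏ p ∈ Finset.univ \ B, w (plaquetteHolonomy U p.1 p.2.1.1 p.2.1.2))))⁻¹) U +
          ∫⁻ V₁, ∫⁻ V₂, ENNReal.ofReal (min (1 - imhAccept (fun U : GaugeConfig d L G => (((∫ V, ∏ p : Plaquette d L, w (plaquetteHolonomy V p.1 p.2.1.1 p.2.1.2) ∂(Measure.pi fun _ : Edge d L => haarProbability G)) /
          ((∫ V, ∏ p ∈ B, w (plaquetteHolonomy V p.1 p.2.1.1 p.2.1.2)
            ∂(Measure.pi fun _ : Edge d L => haarProbability G)) *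
            ∏ p ∈ Finset.univ \ B, w (plaquetteHolonomy U p.1 p.2.1.1 p.2.1.2))))⁻¹) U V₁) ((fun U : GaugeConfig d L G => (((∫ V, ∏ p : Plaquette d L, w (plaquetteHolonomy V p.1 p.2.1.1 p.2.1.2) ∂(Measure.pi fun _ : Edge d L => haarProbability G)) /
          ((∫ V, ∏ p ∈ B, w (plaquetteHolonomy V p.1 p.2.1.1 p.2.1.2)
            ∂(Measure.pi fun _ : Edge d L => haarProbability G)) *
            ∏ p ∈ Finset.univ \ B, w (plaquetteHolonomy U p.1 p.2.1.1 p.2.1.2))))⁻¹) V₂ * (1 - imhAccept (fun U : GaugeConfig d L G => (((∫ V, ∏ p : Plaquette d L, w (plaquetteHolonomy V p.1 p.2.1.1 p.2.1.2) ∂(Measure.pi fun _ : Edge d L => haarProbability G)) /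
          ((∫ V, ∏ p ∈ B, w (plaquetteHolonomy V p.1 p.2.1.1 p.2.1.2)
            ∂(Measure.pi fun _ : Edge d L => haarProbability G)) *
            ∏ p ∈ Finset.univ \ B, w (plaquetteHolonomy U p.1 p.2.1.1 p.2.1.2))))⁻¹) V₂ V₁) / (fun U : GaugeConfig d L G => (((∫ V, ∏ p : Plaquette d L, w (plaquetteHolonomy V p.1 p.2.1.1 p.2.1.2) ∂(Measure.pi fun _ : Edge d L => haarProbability G)) /
          ((∫ V, ∏ p ∈ B, w (plaquetteHolonomy V p.1 p.2.1.1 p.2.1.2)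
            ∂(Measure.pi fun _ : Edge d L => haarProbability G)) *
            ∏ p ∈ Finset.univ \ B, w (plaquetteHolonomy U p.1 p.2.1.1 p.2.1.2))))⁻¹) U)) ∂q ∂q)) * S.indicator 1 U)
    (μ₀ : Measure (GaugeConfig d L G)) [IsProbabilityMeasure μ₀] (tt : ℕ) (S : Set (GaugeConfig d L G)) :
    |((fun ν : Measure (GaugeConfig d L G) => ν.bind K)^[tt] μ₀).real S - π.real S| ≤
      (1 - (∫ V, ∏ p : Plaquette d L, w (plaquetteHolonomy V p.1 p.2.1.1 p.2.1.2) ∂(Measure.pi fun _ : Edge d L => haarProbability G)) / ((∫ g, w g ∂(haarProbability G)) ^ B.card * M₀ ^ (Finset.univ \ B).card)) ^ tt := by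
  obtain ⟨hA, hρq, hmax, hρm, hρpos⟩ := heatBath_cold_acceptMass_eq hL hw hm0 hm hM hw1 B t ht rank hrank π q hπ hq
  set cold : GaugeConfig d L G := fun _ => (1 : G) with hcold
  set ρ : GaugeConfig d L G → ℝ := fun U => ((∫ V, ∏ p : Plaquette d L, w (plaquetteHolonomy V p.1 p.2.1.1 p.2.1.2) ∂(Measure.pi fun _ : Edge d L => haarProbability G)) /
          ((∫ V, ∏ p ∈ B, w (plaquetteHolonomy V p.1 p.2.1.1 p.2.1.2)
            ∂(Measure.pi fun _ : Edge d L => haarProbability G)) *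
            ∏ p ∈ Finset.univ \ B, w (plaquetteHolonomy U p.1 p.2.1.1 p.2.1.2))) with hρ
  have hw0' : ∀ U, 0 < (ρ U)⁻¹ := fun U => inv_pos.2 (hρpos U)
  have hwm' : Measurable fun U => (ρ U)⁻¹ := hρm.inv
  have hπ' : (q.withDensity fun U => ENNReal.ofReal (ρ U)⁻¹) = π := withDensity_inv_density hρm hρpos hρq
  haveI : IsProbabilityMeasure (q.withDensity fun U => ENNReal.ofReal (ρ U)⁻¹) := by rw [hπ']; infer_instance
  have hone : ∫⁻ y, ENNReal.ofReal (ρ y)⁻¹ ∂q = ENNReal.ofReal 1 := by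
    have h : π Set.univ = 1 := measure_univ
    rw [← hπ', withDensity_apply _ MeasurableSet.univ, Measure.restrict_univ] at h
    rw [h, ENNReal.ofReal_one]
  have hA' := imhAcceptMass_toReal_eq_of_forall_le (q := q) hw0' cold hmax zero_le_one hone
  have hW : ((ρ cold)⁻¹)⁻¹ = (∫ V, ∏ p : Plaquette d L, w (plaquetteHolonomy V p.1 p.2.1.1 p.2.1.2) ∂(Measure.pi fun _ : Edge d L => haarProbability G)) / ((∫ g, w g ∂(haarProbability G)) ^ B.card * M₀ ^ (Finset.univ \ B).card) := by
    rw [← hA, hA', one_div]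
  have h := dr_uniformlyErgodic (q := q) (w := fun U => (ρ U)⁻¹) hwm' hw0' (W := (ρ cold)⁻¹) hmax K hK μ₀ tt S
  rw [hπ', hW] at h
  exact h

end Summit.Ventures.LatticeQCDFlow.Theory2.Autoregressive
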